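import Literature.AlgebraicGeometry.Resolution.FiniteBirationalNormal
import Literature.AlgebraicGeometry.Resolution.RegularLocalRingsNormal
import Literature.AlgebraicGeometry.Resolution.SmoothStalksRegular
import Mathlib.RingTheory.Smooth.IntegralClosure
import Mathlib.RingTheory.Localization.BaseChange
import Mathlib.RingTheory.LocalProperties.IntegrallyClosed
import HarnessLib

/-!
# Smooth over normal is normal (Stacks 033C)

Topic: `Literature/AlgebraicGeometry/Resolution`. For a dominant morphism `f : X → S` of integral
schemes, locally of finite presentation, with `S` normal (all local rings integrally closed),
every point of the smooth locus `sm(X/S)` is a normal point of `X`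
(`isIntegrallyClosed_stalk_of_mem_smoothLocus`). This is the remark "`x` is a normal point of
`X`, as `S` is normal" (for `x ∈ sm(X/S)`) in the proof of de Jong 1996, Lemma 4.20, and
Stacks 033C ("smooth over normal is normal").

Proof (no Serre criterion needed): on affine charts `R = Γ(S, U) → A = Γ(X, V)` is a smooth,
injective map of domains with `R` integrally closed, `K = Frac R`. Mathlib's
`TensorProduct.toIntegralClosure_bijective_of_smooth` (Stacks 03GE: smooth base change commutes
with integral closure) applied to `R ⊆ K` says that `A` is integrally closed in
`L = A ⊗_R K = A[(R ∖ 0)⁻¹] ⊆ Frac A`; and `L`, a smooth algebra over the field `K`, has regular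
local rings (Stacks 056S, `isRegularLocalRing_stalk_of_smooth_of_field`), hence is integrally
closed (Matsumura 19.4, `isIntegrallyClosed_of_isRegularLocalRing`). So an element of `Frac A`
integral over `A` lies in `L` and then in `A`.

## References

* The Stacks Project, Tag 033C, Tag 03GE, Tag 056S.
* A. J. de Jong, *Smoothness, semi-stability and alterations*, Publ. Math. IHÉS 83 (1996),
  proof of Lemma 4.20, p. 73.
-/

noncomputable section

open CategoryTheory CategoryTheory.Limits AlgebraicGeometry TopologicalSpace Topology
  TensorProduct

namespace Literature.AlgebraicGeometry.Resolution

universe u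

/-! ## A smooth algebra over a field is normal -/

/-- The localisations at primes of a smooth algebra over a field are regular local rings
(Stacks 056S, via the scheme-level `isRegularLocalRing_stalk_of_smooth_of_field`).
[cite: StacksProject, Tag 056S] -/
theorem isRegularLocalRing_localization_of_smooth_of_field (K L : Type u) [Field K]
    [CommRing L] [Algebra K L] [Algebra.Smooth K L] (p : Ideal L) [p.IsPrime] :
    IsRegularLocalRing (Localization.AtPrime p) := by
  have hsm : Smooth (Spec.map (CommRingCat.ofHom (algebraMap K L))) := by
    rw [HasRingHomProperty.Spec_iff (P := @Smooth), CommRingCat.hom_ofHom,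
      RingHom.smooth_algebraMap]
    infer_instance
  let x : Spec (CommRingCat.of L) := ⟨p, inferInstance⟩
  have hreg := isRegularLocalRing_stalk_of_smooth_of_field
    (Spec.map (CommRingCat.ofHom (algebraMap K L))) x
  letI : Algebra L ((Spec (CommRingCat.of L)).presheaf.stalk x) :=
    inferInstanceAs (Algebra L ((Spec.structureSheaf (CommRingCat.of L)).presheaf.stalk x))
  haveI : IsLocalization.AtPrime ((Spec (CommRingCat.of L)).presheaf.stalk x) p :=
    StructureSheaf.IsLocalization.to_stalk (CommRingCat.of L) x
  exact IsRegularLocalRing.of_ringEquiv (IsLocalization.algEquiv p.primeCompl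
    ((Spec (CommRingCat.of L)).presheaf.stalk x) (Localization.AtPrime p)).toRingEquiv

/-- A smooth domain over a field is integrally closed (its local rings are regular, hence
integrally closed, Matsumura 19.4, and being integrally closed is a local property).
[cite: StacksProject, Tag 056S] -/
theorem isIntegrallyClosed_of_smooth_of_field (K L : Type u) [Field K] [CommRing L] [IsDomain L]
    [Algebra K L] [Algebra.Smooth K L] : IsIntegrallyClosed L := by
  refine IsIntegrallyClosed.of_localization_maximal fun p _ hp => ?_
  haveI := hp.isPrime
  haveI := isRegularLocalRing_localization_of_smooth_of_field K L p
  exact isIntegrallyClosed_of_isRegularLocalRing (Localization.AtPrime p)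

/-! ## Smooth over a normal domain is normal -/

section Ring

/-- In `A ⊗_R R'`, with `R → R'` surjective, every element is of the form `a ⊗ 1`. [folklore] -/
theorem exists_eq_tmul_one_of_surjective (R A : Type u) [CommRing R] [CommRing A] [Algebra R A]
    {R' : Type u} [CommRing R'] [Algebra R R']
    (h : Function.Surjective (algebraMap R R')) (w : A ⊗[R] R') : ∃ a : A, w = a ⊗ₜ 1 := by
  induction w using TensorProduct.induction_on with
  | zero => exact ⟨0, by simp⟩
  | tmul a c =>
    obtain ⟨r, rfl⟩ := h c
    refine ⟨r • a, ?_⟩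
    rw [Algebra.algebraMap_eq_smul_one, TensorProduct.tmul_smul, TensorProduct.smul_tmul']
  | add x y hx hy =>
    obtain ⟨a, rfl⟩ := hx
    obtain ⟨b, rfl⟩ := hy
    exact ⟨a + b, by rw [TensorProduct.add_tmul]⟩

/-- **Smooth over normal is normal, ring form** (Stacks 033C): a domain `A` smooth over an
integrally closed domain `R ⊆ A` is integrally closed. With `K = Frac R` and
`L = A[(R∖0)⁻¹] ≅ A ⊗_R K ⊆ Frac A`: `L` is smooth over the field `K`, hence integrally closed
(`isIntegrallyClosed_of_smooth_of_field`), and `A` is integrally closed in `L` because smooth base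
change commutes with integral closure (Stacks 03GE, Mathlib
`TensorProduct.toIntegralClosure_bijective_of_smooth`, applied to `R ⊆ K`).
[cite: StacksProject, Tag 033C] -/
theorem isIntegrallyClosed_of_smooth_of_isIntegrallyClosed (R A : Type u) [CommRing R] [IsDomain R]
    [IsIntegrallyClosed R] [CommRing A] [IsDomain A] [Algebra R A] [FaithfulSMul R A]
    [Algebra.Smooth R A] : IsIntegrallyClosed A := by
  classical
  let K := FractionRing R
  let M : Submonoid A := Algebra.algebraMapSubmonoid A (nonZeroDivisors R)
  have hM : M ≤ nonZeroDivisors A := by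
    rintro _ ⟨r, hr, rfl⟩
    exact map_mem_nonZeroDivisors (algebraMap R A) (FaithfulSMul.algebraMap_injective R A) hr
  let L := Localization M
  haveI : IsDomain L := IsLocalization.isDomain_localization hM
  let F := FractionRing A
  letI : Algebra L F := IsLocalization.localizationAlgebraOfSubmonoidLe L F M (nonZeroDivisors A) hM
  haveI : IsScalarTower A L F :=
    IsLocalization.localization_isScalarTower_of_submonoid_le L F M (nonZeroDivisors A) hM
  haveI : IsFractionRing L F :=
    IsFractionRing.isFractionRing_of_isDomain_of_isLocalization M L F
  -- `L ≅ K ⊗_R A` is smooth over the field `K`, hence integrally closed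
  haveI : Algebra.Smooth K L :=
    Algebra.Smooth.of_equiv (Localization.tensorRightAlgEquiv (nonZeroDivisors R) A)
  haveI : IsIntegrallyClosed L := isIntegrallyClosed_of_smooth_of_field K L
  refine (isIntegrallyClosed_iff F).mpr fun {z} hz => ?_
  -- `z ∈ L`
  have hzL : IsIntegral L z := hz.tower_top
  obtain ⟨ℓ, hℓ⟩ : ∃ ℓ : L, algebraMap L F ℓ = z := IsIntegrallyClosed.isIntegral_iff.mp hzL
  have hℓA : IsIntegral A ℓ := by
    have h1 : IsIntegral A (IsScalarTower.toAlgHom A L F ℓ) := by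
      rw [IsScalarTower.coe_toAlgHom', hℓ]; exact hz
    exact (isIntegral_algHom_iff (IsScalarTower.toAlgHom A L F)
      (FaithfulSMul.algebraMap_injective L F)).mp h1
  -- `A` is integrally closed in `A ⊗_R K ≅ L`
  let e : A ⊗[R] K ≃ₐ[A] L := Localization.tensorLeftAlgEquiv (nonZeroDivisors R) A
  have hℓ' : IsIntegral A (e.symm ℓ) := hℓA.map e.symm.toAlgHom
  obtain ⟨w, hw⟩ := (TensorProduct.toIntegralClosure_bijective_of_smooth (R := R) (S := A)
    (B := K)).2 ⟨e.symm ℓ, hℓ'⟩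
  have hsurj : Function.Surjective (algebraMap R (integralClosure R K)) := fun c =>
    ⟨(IsIntegrallyClosed.isIntegral_iff.mp c.2).choose,
      Subtype.ext (IsIntegrallyClosed.isIntegral_iff.mp c.2).choose_spec⟩
  obtain ⟨a₀, ha₀⟩ := exists_eq_tmul_one_of_surjective R A hsurj w
  have key : (e.symm ℓ : A ⊗[R] K) = a₀ ⊗ₜ 1 := by
    have h1 := congrArg Subtype.val hw
    rw [ha₀] at h1
    change _ = e.symm ℓ at h1
    rw [← h1]
    simp [TensorProduct.toIntegralClosure]
  refine ⟨a₀, ?_⟩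
  have h2 : e (a₀ ⊗ₜ 1) = algebraMap A L a₀ := Localization.tensorLeftAlgEquiv_apply_tmul_one _ a₀
  calc algebraMap A F a₀ = algebraMap L F (algebraMap A L a₀) := IsScalarTower.algebraMap_apply A L F a₀
    _ = algebraMap L F ℓ := by rw [← h2, ← key, AlgEquiv.apply_symm_apply]
    _ = z := hℓ

end Ring

/-! ## Scheme level: points of the smooth locus over a normal base are normal -/

/-- **Smooth over normal is normal** (Stacks 033C), pointwise on the smooth locus: for a
dominant quasi-compact morphism `f : X → S` of integral schemes, locally of finite presentation,
with all local rings of `S` integrally closed, the local ring of `X` at every point of the smooth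
locus `sm(X/S)` is integrally closed — de Jong 1996, proof of 4.20: "If `x` lies in the smooth
locus of `f : X → S` […] then `x` is a normal point of `X`, as `S` is normal." On affine charts
`Γ(S, U) → Γ(X, V)` is a smooth injective map of domains (`exists_smooth_of_formallySmooth_stalk`),
so `Γ(X, V)` is integrally closed (`isIntegrallyClosed_of_smooth_of_isIntegrallyClosed`), and
`𝒪_{X,x}` is a localisation of it. [cite: DeJong1996, proof of Lemma 4.20, p. 73] -/
theorem isIntegrallyClosed_stalk_of_mem_smoothLocus {X S : Scheme.{u}} [IsIntegral X]
    [IsIntegral S] (f : X ⟶ S) [LocallyOfFinitePresentation f] [IsDominant f] [QuasiCompact f]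
    (hS : ∀ s : S, IsIntegrallyClosed (S.presheaf.stalk s)) {x : X} (hx : x ∈ f.smoothLocus) :
    IsIntegrallyClosed (X.presheaf.stalk x) := by
  obtain ⟨U, hU, V, hV, hVU, hxV, hsm⟩ := exists_smooth_of_formallySmooth_stalk f x hx
  haveI : Nonempty U := ⟨⟨f x, hVU hxV⟩⟩
  haveI : Nonempty V := ⟨⟨x, hxV⟩⟩
  haveI : IsSchemeTheoreticallyDominant f := .of_isDominant f
  algebraize [(f.appLE U V hVU).hom]
  haveI : IsIntegrallyClosed Γ(S, U) := isIntegrallyClosed_sections_of_stalk hS ⟨U, hU⟩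
  haveI : FaithfulSMul Γ(S, U) Γ(X, V) := by
    rw [faithfulSMul_iff_algebraMap_injective]
    show Function.Injective (f.appLE U V hVU)
    rw [Scheme.Hom.appLE]
    exact (map_injective_of_isIntegral (X := X) (homOfLE hVU)).comp (f.app_injective U)
  have hA : IsIntegrallyClosed Γ(X, V) :=
    isIntegrallyClosed_of_smooth_of_isIntegrallyClosed Γ(S, U) Γ(X, V)
  letI := TopCat.Presheaf.algebra_section_stalk X.presheaf (⟨x, hxV⟩ : V)
  haveI : IsLocalization.AtPrime (X.presheaf.stalk x) (hV.primeIdealOf ⟨x, hxV⟩).asIdeal :=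
    hV.isLocalization_stalk ⟨x, hxV⟩
  exact isIntegrallyClosed_of_isLocalization _ (hV.primeIdealOf ⟨x, hxV⟩).asIdeal.primeCompl
    (Ideal.primeCompl_le_nonZeroDivisors _)

/-- The same over an open `W ⊆ sm(X/S)` regarded as a scheme: all local rings of `W` are
integrally closed. [cite: StacksProject, Tag 033C] -/
theorem isIntegrallyClosed_stalk_opens_of_le_smoothLocus {X S : Scheme.{u}} [IsIntegral X]
    [IsIntegral S] (f : X ⟶ S) [LocallyOfFinitePresentation f] [IsDominant f] [QuasiCompact f]
    (hS : ∀ s : S, IsIntegrallyClosed (S.presheaf.stalk s)) {W : X.Opens}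
    (hW : W ≤ f.smoothLocus) (w : W) : IsIntegrallyClosed ((W : Scheme.{u}).presheaf.stalk w) := by
  have h : IsIntegrallyClosed (X.presheaf.stalk (W.ι w)) :=
    isIntegrallyClosed_stalk_of_mem_smoothLocus f hS (hW (by simp))
  exact IsIntegrallyClosed.of_equiv (asIso (W.ι.stalkMap w)).commRingCatIsoToRingEquiv

end Literature.AlgebraicGeometry.Resolution

end
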